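/-
Copyright (c) 2026 the pub-hodgecm-mathlib formalisation cell (harness21).  Prover seat hodgecm-mathlib-K2E1b-p02 (g0), Track B ∕ K2-LIT
(build stream 29), h413 = `stmt-HodgeConjecture-24833`, line `K2_E1b_GKCohomologyU21`, socket module «U0 TwistIntegration», file #4 — the payment of
`K2E1bGKCohomologyU21.U0.sig_K2E1bDatumTwistActs` TOKEN FOR TOKEN.  2026-09-03.
-/
import Summits.HodgeConjecture.HodgeConjecture.Theorems.K2E1bKTypeTwistDefs        -- ★ defs leaf: `IsTwistOf`, `ActsOnKTypesTwist`
import Summits.HodgeConjecture.HodgeConjecture.Theorems.F0P3bStubW1KIntegration     -- ★ `actsOnKTypes_kovLie` (the `e = 0` formulas for ANY datum)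
import HarnessLib

/-!
# h413 ∕ Track B «K2-LIT», line `K2_E1b_GKCohomologyU21`, unit U0 «TWIST INTEGRATION», file #4: THE TWISTED `u`-BASIS FORMULAS ON `𝔨`
# (payment of `Cruxes/H413/Lines/K2_E1b_GKCohomologyU21_U0_TwistIntegration.lean :: sig_K2E1bDatumTwistActs`, statement bytes frozen)

Cell `pub/hodgecm-mathlib`, crux H413 = `stmt-HodgeConjecture-24833`, route of record `HCCMUnconditional`; chair K2-lead (g0), dealer K2E1b-plan (g0),
EMIT «SKELETON LANDED K2E1b» (REQUESTS l.72387) file #4 `sig_K2E1bDatumTwistActs` (M) ↦ seat K2E1b-p02.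
THEOREMS ONLY (no `def`, no `instance`, no `notation`, no named-fact hypothesis, no `sorry`); imports = two ★ `Theorems/` leaves + HarnessLib;
lane `--supports stmt-HodgeConjecture-24833 --as helper` (count-neutral: one brick of the CENTRAL TWIST package #2–#10 of the line; it does not move 24833).

THE STATEMENT (bytes of the socket).  For EVERY Kovačević datum `𝒟` ([Kovacevic2021 §3 Def. 1]: a set `S` of `K`-types `(n, m)` with the arrow
coefficients, carrying the `𝔤𝔩(3, ℂ)`-action `𝒟.ρ` on `V = ⊕_{(n,m) ∈ S} ⟨u^1_{n,m}, …, u^n_{n,m}⟩` with the centre acting by `0`), every `e : ℤ`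
and every real Lie homomorphism `σ : 𝔲(2,1) → End V` which IS the central twist of `𝒟.ρ` by `e∕3` (★ `IsTwistOf 𝒟.ρ (e/3) σ`:
`σ(X) = kovLie 𝒟.ρ X + (e∕3)·tr(X)·1`), the restriction `σ|_𝔨` acts on the basis `u^k_{n,m}` (`(n, m) ∈ S`, `1 ≤ k ≤ n`) by the TWISTED `u`-basis
formulas ★ `ActsOnKTypesTwist 𝒟.S e σ`: Kovačević's block-diagonal formulas (`H_α ↦ n+1−2k`, `H_β ↦ (m−n−1+2k)∕2`, `X_α = E₀₁ ↦ −(k−1)(n+1−k) u^{k−1}`,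
`Y_α = E₁₀ ↦ −u^{k+1}`) PLUS the central term `(e∕3)·(x₀₀ + x₁₁ + x₂₂)·u^k`.

WHY THE LINE WANTS IT (card `K2_E1b_GKCohomologyU21.md`, unit U0).  ★ `isGKModule_kTypeRep` integrates Kovačević's modules to `(𝔲(2,1), K)`-modules only
for the TRIVIAL central character; Rogawski's table [Rogawski1990 §12.3 pp. 176–178] needs `J^±_φ`, `D_φ`, `π²_φ` for every `φ = (a, b, c)`, where the
centre `i·1` acts by `i·e(φ)`, `e = a + b + c`.  The twisted `𝔨`-formulas proved here are the hypothesis of the twisted `K`-integration #5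
(`sig_K2E1bKTypeTwistGK`: exponents `a' = (m − 3n + 3 + 2e)∕6`, `b' = (e − m)∕3`) and of admissibility #6.

THE PROOF (strategy: REUSE, no recomputation of Kovačević's coordinates).  Unfolding `IsTwistOf` at `X ∈ 𝔨`,
`σ(X) u^k = (kovLie 𝒟.ρ X) u^k + (e∕3)·tr(X)·u^k`.  The first summand is, for ANY datum, Kovačević's formula — ★
`F0P3bStubW1KIntegration.actsOnKTypes_kovLie 𝒟 : ActsOnKTypes 𝒟.S (kovLie 𝒟.ρ)` (the eight-operator decomposition `SU21Datum.ρfun` of the reindexed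
block-diagonal matrix, whose `𝔭`-coefficients vanish on `𝔨`, + ★ `Ha_vec ∕ Hb_vec ∕ Xa_vec ∕ Ya_vec`; the datum-free `kvec 𝒟.S` IS `𝒟.vec`).  The second is
the scalar `(e∕3)·(x₀₀ + x₁₁ + x₂₂)` once the trace over `Fin 2 ⊕ Fin 1` is split (`trace_compactLie_inclusion`).  Three declarations:

* §1 `trace_compactLie_inclusion` · `tr(X) = x₀₀ + x₁₁ + x₂₂` for `X ∈ 𝔨 ⊂ 𝔲(2,1)` viewed in `𝔲(2,1)` (pure `Fintype.sum_sum_type` bookkeeping);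
* §1 `twist_inclusion_apply`     · `σ(X) v = (kovLie 𝒟.ρ X) v + ((e∕3)·(x₀₀ + x₁₁ + x₂₂)) • v` for a twist `σ` and `X ∈ 𝔨`;
* §2 **`DatumTwistActs`**         · `sig_K2E1bDatumTwistActs` TOKEN FOR TOKEN (by-name tie probe
      `example : type_of% @DatumTwistActs = type_of% @K2E1bGKCohomologyU21.U0.sig_K2E1bDatumTwistActs := rfl` at home once both modules are built on
      stream 29: `K2/K2E1b-p02/g0/Probe_K2E1bDatumTwistActs.lean`).

WHAT IS NOT HERE.  The existence of the twist `σ` (#3 `sig_K2E1bKovLieTwist`), the twisted `K`-action and its `(𝔤, K)`-structure (#5), admissibility (#6),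
χ-scalars (#7), unitarity ∕ irreducibility transport (#8–#9), the per-datum packaging (#10).

HONEST LABEL.  HC_CM is proved only modulo the 7 printed citations (2 remaining named inputs: hLiu418 = `stmt-HodgeConjecture-24832`, h413 =
`stmt-HodgeConjecture-24833`) until rung 0 closes; this file moves no counter.

## References
* [Kovacevic2021] D. Kovačević, *the `(𝔤, K)`-modules of `SU(2,1)` from `K`-types* (2021), §3 Def. 1 (the `u`-basis formulas of `𝔨 = 𝔤𝔩(2) ⊕ 𝔤𝔩(1)`),
  Thm. 1–2 (the eight-operator action `ρfun`) — kernel-checked source ★ `Literature.RepresentationTheory.Kovacevic2021.SU21ModulesFromKTypes`.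
* [BorelWallach2000] A. Borel, N. Wallach, *Continuous Cohomology, Discrete Subgroups, and Representations of Reductive Groups*, 2nd ed., AMS 2000 —
  0 §2.5, VI §4 4.7–4.8 (the `(𝔤, K)`-module frame the formulas feed).
* [Rogawski1990] J. Rogawski, *Automorphic representations of unitary groups in three variables*, Ann. of Math. Stud. 123 (1990), §12.3 p. 177
  (the centre of the enveloping algebra acts on `J^±_φ`, `D_φ`, `π²_φ` by the character of `F_φ`; context: why `e ≠ 0` is needed).
-/

set_option autoImplicit false
-- the mandated namespace repeats the single-problem summit's segment (`HodgeConjecture.HodgeConjecture`)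
set_option linter.dupNamespace false

namespace Summit.HodgeConjecture.HodgeConjecture.Cruxes.H413.K2E1bDatumTwistActs

open Literature.NumberTheory.Automorphic
open Literature.RepresentationTheory.KonnoKonno2007 Literature.RepresentationTheory.KonnoKonno2007.RealDualPair
open Literature.RepresentationTheory.KonnoKonno2007.RealDualPair.UForm
open Literature.RepresentationTheory.Kovacevic2021 Literature.RepresentationTheory.Kovacevic2021.SU21Datum
open Summit.HodgeConjecture.HodgeConjecture.Cruxes.H413.F0P3bLocalAPacketsDefs
open Summit.HodgeConjecture.HodgeConjecture.Cruxes.H413.F0P3bU21Restriction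
open Summit.HodgeConjecture.HodgeConjecture.Cruxes.H413.F0P3bKTypeIntegration (KIdx kvec ActsOnKTypes)
open Summit.HodgeConjecture.HodgeConjecture.Cruxes.H413.F0P3bStubW1KIntegration (actsOnKTypes_kovLie)
open Summit.HodgeConjecture.HodgeConjecture.Cruxes.H413.K2E1bGKCohomologyU21 (IsTwistOf ActsOnKTypesTwist)

-- Mathlib idiom (Mathlib/Algebra/Lie/OfAssociative.lean itself, `GKModules`, the `Upq*` files, ★ `F0P3bKTypeIntegrationGK`, the defs leaf and the
-- socket module): the commutator bracket on `Module.End ℂ V`, needed to even STATE `𝔲(2,1) →ₗ⁅ℝ⁆ Module.End ℂ V` (re-asserts Mathlib's own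
-- priority-100 structure; no library instance is overridden)
attribute [local instance 100] LieRing.ofAssociativeRing

/-! ## §1 Bookkeeping: the trace of a `𝔨`-element and the twist on `𝔨` -/

/-- **`tr(X) = x₀₀ + x₁₁ + x₂₂`** for `X ∈ 𝔨 = 𝔲(2) ⊕ 𝔲(1) ⊂ 𝔲(2,1)` viewed in `𝔲(2,1)` (the inclusion does not change the matrix; the trace over
`Fin 2 ⊕ Fin 1` splits as the `Fin 2`-block plus the `Fin 1`-block).  [folklore] -/
theorem trace_compactLie_inclusion (X : (uFormGroup (Fin 2) (Fin 1)).compactLie) :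
    ((LieSubalgebra.inclusion (uFormGroup (Fin 2) (Fin 1)).compactLie_le_lie X : (uFormGroup (Fin 2) (Fin 1)).lie) :
        Matrix (Fin 2 ⊕ Fin 1) (Fin 2 ⊕ Fin 1) ℂ).trace =
      (X : Matrix (Fin 2 ⊕ Fin 1) (Fin 2 ⊕ Fin 1) ℂ) (Sum.inl 0) (Sum.inl 0)
        + (X : Matrix (Fin 2 ⊕ Fin 1) (Fin 2 ⊕ Fin 1) ℂ) (Sum.inl 1) (Sum.inl 1)
        + (X : Matrix (Fin 2 ⊕ Fin 1) (Fin 2 ⊕ Fin 1) ℂ) (Sum.inr 0) (Sum.inr 0) := by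
  rw [LieSubalgebra.coe_inclusion, Matrix.trace, Fintype.sum_sum_type, Fin.sum_univ_two, Fin.sum_univ_one]
  rfl

/-- **The twist on `𝔨`, pointwise**: if `σ` is the central twist of `𝒟.ρ` by `e∕3` (★ `IsTwistOf`), then for `X ∈ 𝔨` and every `v`,
`σ(X) v = (kovLie 𝒟.ρ X) v + ((e∕3)·(x₀₀ + x₁₁ + x₂₂)) • v`.  [cite: Kovacevic2021, §3 Def. 1] -/
theorem twist_inclusion_apply (𝒟 : SU21Datum) (e : ℤ) (σ : G21.lie →ₗ⁅ℝ⁆ Module.End ℂ 𝒟.V)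
    (hσ : IsTwistOf 𝒟.ρ ((e : ℂ) / 3) σ) (X : (uFormGroup (Fin 2) (Fin 1)).compactLie) (v : 𝒟.V) :
    σ (LieSubalgebra.inclusion (uFormGroup (Fin 2) (Fin 1)).compactLie_le_lie X) v =
      kovLie 𝒟.ρ (LieSubalgebra.inclusion (uFormGroup (Fin 2) (Fin 1)).compactLie_le_lie X) v
        + (((e : ℂ) / 3) * ((X : Matrix (Fin 2 ⊕ Fin 1) (Fin 2 ⊕ Fin 1) ℂ) (Sum.inl 0) (Sum.inl 0)
            + (X : Matrix (Fin 2 ⊕ Fin 1) (Fin 2 ⊕ Fin 1) ℂ) (Sum.inl 1) (Sum.inl 1)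
            + (X : Matrix (Fin 2 ⊕ Fin 1) (Fin 2 ⊕ Fin 1) ℂ) (Sum.inr 0) (Sum.inr 0))) • v := by
  rw [hσ, LinearMap.add_apply, LinearMap.smul_apply, Module.End.one_apply, trace_compactLie_inclusion]

/-! ## §2 The socket `sig_K2E1bDatumTwistActs`, token for token -/

/-- **Socket #4 `sig_K2E1bDatumTwistActs` of `Cruxes/H413/Lines/K2_E1b_GKCohomologyU21_U0_TwistIntegration.lean` (statement bytes frozen).**
For EVERY Kovačević datum `𝒟` and every `e`, the twist `σ` of `𝒟.ρ` by `e∕3` acts on the basis `u^k_{n,m}` by the twisted `u`-basis formulas on `𝔨` —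
read off ★ `SU21Datum.ρfun` on block-diagonal matrices exactly as ★ `F0P3bKTypeIntegrationGK` §3 ∕ ★ `F0P3bStubW1KIntegration.actsOnKTypes_kovLie` do for
`e = 0`, plus the scalar `(e∕3)·tr(X)`.  Proof: `twist_inclusion_apply` + ★ `actsOnKTypes_kovLie 𝒟` on the first summand.
[cite: Kovacevic2021, §3 Def. 1] [cite: BorelWallach2000, VI §4 4.7–4.8] -/
theorem DatumTwistActs :
    ∀ (𝒟 : SU21Datum) (e : ℤ) (σ : G21.lie →ₗ⁅ℝ⁆ Module.End ℂ 𝒟.V),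
      IsTwistOf 𝒟.ρ ((e : ℂ) / 3) σ → ActsOnKTypesTwist 𝒟.S e σ := by
  intro 𝒟 e σ hσ X n m k hnm hk hkn
  rw [twist_inclusion_apply 𝒟 e σ hσ X, actsOnKTypes_kovLie 𝒟 X n m k hnm hk hkn]

end Summit.HodgeConjecture.HodgeConjecture.Cruxes.H413.K2E1bDatumTwistActs
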